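import Mathlib
import Summits.Ventures.PercRepro2.Defs
import Summits.Ventures.PercRepro2.Graph
import Summits.Ventures.PercRepro2.OneColourSwitch
import Summits.Ventures.PercRepro2.RegionHubSign
import Summits.Ventures.PercRepro2.SideSwitch
import Summits.Ventures.PercRepro2.SideSwitchFibre
import Summits.Ventures.PercRepro2.SideSwitchClosed

/-!
# The components of the sided set (blind cell PercRepro2, p3 g18, 2026-08-27;
`proofs/P3-CPNC.md` §15c, general form)

`comps ρ` are the connected components of the graph induced on the sided set
`A0 = (K₂ ∪ M₂) ∖ {r, s}` — the clusters of the configuration `chi` opening exactly the edges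
inside `A0`.  They are closed inside the sided set (`closedIn_of_mem_comps`), partition `A0`
(`unionT_comps`, `unionT_sdiff_comps`, `mem_of_subset_unionT`), and a union of components
(`unionT`) is closed (`closedIn_unionT`); `assignC T ρ = ρ ⊕ touches (⋃ T)` is the colouring with
the components of `T` on the `W`-side.  Own work; std axioms.
-/

namespace Summit.Ventures.PercRepro2

namespace SideSwitch

open Finset Classical RegionHub OneColourSwitch

variable {V : Type*} {E : Type*}

/-- The sided set is the coercion of `A0`. -/
lemma sided_eq_coe_A0 [Fintype V] [DecidableEq V] {ends : E → Sym2 V} (r s : V) (ω : Config E) :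
    sided ends r s ω = (↑(A0 ends r s ω) : Set V) := by
  ext x
  rw [Finset.mem_coe, mem_A0]
  exact Iff.rfl

section Count

variable [Fintype V] [DecidableEq V]

variable (ends : E → Sym2 V)

/-- The configuration opening exactly the edges inside `S`. -/
noncomputable def chi (S : Set V) : Config E := fun e => decide (e ∈ within ends S)

/-- The component of `x` inside `S`: the cluster of `x` in `chi S`. -/
noncomputable def compIn (S : Set V) (x : V) : Finset V :=
  univ.filter (fun y => Conn ends (chi ends S) x y)

/-- The components of the sided set of `ω`. -/
noncomputable def comps (r s : V) (ω : Config E) : Finset (Finset V) :=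
  (A0 ends r s ω).image (compIn ends (↑(A0 ends r s ω) : Set V))

/-- The union of a set of components. -/
def unionT (T : Finset (Finset V)) : Finset V := T.biUnion id

/-- The colouring with the components of `T` on the `W`-side. -/
noncomputable def assignC (T : Finset (Finset V)) (ρ : Config E) : Config E :=
  assign ends (unionT T) ρ

variable {ends}

omit [DecidableEq V] in
/-- Membership in a component. -/
lemma mem_compIn {S : Set V} {x y : V} :
    y ∈ compIn ends S x ↔ Conn ends (chi ends S) x y := by
  simp [compIn]

omit [Fintype V] [DecidableEq V] in
/-- `chi S` opens exactly the edges inside `S`. -/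
lemma chi_eq_true_iff {S : Set V} {e : E} : chi ends S e = true ↔ e ∈ within ends S := by
  simp [chi]

omit [DecidableEq V] in
/-- A vertex of a component of `S` lies in `S`. -/
lemma mem_of_mem_compIn {S : Set V} {x y : V} (hx : x ∈ S) (hy : y ∈ compIn ends S x) : y ∈ S := by
  rw [mem_compIn] at hy
  refine mem_of_conn_of_closed (ends := ends) (ω := chi ends S) ?_ hx hy
  intro a ha b hab
  obtain ⟨_, e, he, hends⟩ := openGraph_adj.1 hab
  obtain ⟨u, hu, v, hv, huv⟩ := chi_eq_true_iff.1 he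
  rw [hends, Sym2.eq_iff] at huv
  rcases huv with ⟨_, h2⟩ | ⟨_, h2⟩
  · rw [h2]; exact hv
  · rw [h2]; exact hu

omit [DecidableEq V] in
/-- `x` lies in its own component. -/
lemma mem_compIn_self (S : Set V) (x : V) : x ∈ compIn ends S x :=
  mem_compIn.2 (conn_refl _ _ _)

omit [DecidableEq V] in
/-- The component of a vertex of a component is the component. -/
lemma compIn_eq_of_mem {S : Set V} {x y : V} (hy : y ∈ compIn ends S x) :
    compIn ends S y = compIn ends S x := by
  rw [mem_compIn] at hy
  ext z
  simp only [mem_compIn]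
  constructor
  · exact fun h => conn_trans hy h
  · exact fun h => conn_trans (conn_symm hy) h

omit [DecidableEq V] in
/-- A component of `S` is closed inside `S`. -/
lemma closedIn_compIn {S : Set V} {x : V} (hx : x ∈ S) :
    ClosedIn ends S (↑(compIn ends S x) : Set V) := by
  intro e a b hends ha hb
  have haS : a ∈ S := mem_of_mem_compIn hx (Finset.mem_coe.1 ha)
  have he : chi ends S e = true := chi_eq_true_iff.2 ⟨a, haS, b, hb, hends⟩
  exact Finset.mem_coe.2 (mem_compIn.2 (conn_trans (mem_compIn.1 (Finset.mem_coe.1 ha))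
    (conn_of_openAdj ⟨e, he, hends⟩)))

omit [Fintype V] in
/-- Membership in `unionT`. -/
lemma mem_unionT {T : Finset (Finset V)} {x : V} : x ∈ unionT T ↔ ∃ C ∈ T, x ∈ C := by
  simp [unionT]

/-- Every component of `ω` is the component of each of its vertices. -/
lemma eq_compIn_of_mem_comps {r s : V} {ω : Config E} {C : Finset V} (hC : C ∈ comps ends r s ω)
    {x : V} (hx : x ∈ C) : C = compIn ends (↑(A0 ends r s ω) : Set V) x := by
  obtain ⟨y, _, rfl⟩ := Finset.mem_image.1 hC
  exact (compIn_eq_of_mem hx).symm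

/-- A component is a subset of `A0`. -/
lemma subset_A0_of_mem_comps {r s : V} {ω : Config E} {C : Finset V} (hC : C ∈ comps ends r s ω) :
    C ⊆ A0 ends r s ω := by
  obtain ⟨y, hy, rfl⟩ := Finset.mem_image.1 hC
  exact fun z hz => Finset.mem_coe.1 (mem_of_mem_compIn (Finset.mem_coe.2 hy) hz)

/-- A component is closed inside the sided set. -/
lemma closedIn_of_mem_comps {r s : V} {ω : Config E} {C : Finset V} (hC : C ∈ comps ends r s ω) :
    ClosedIn ends (sided ends r s ω) (↑C : Set V) := by
  obtain ⟨y, hy, rfl⟩ := Finset.mem_image.1 hC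
  rw [sided_eq_coe_A0]
  exact closedIn_compIn (Finset.mem_coe.2 hy)

/-- A union of components is a subset of `A0`. -/
lemma unionT_subset_A0 {r s : V} {ω : Config E} {T : Finset (Finset V)} (hT : T ⊆ comps ends r s ω) :
    unionT T ⊆ A0 ends r s ω := by
  intro x hx
  obtain ⟨C, hC, hxC⟩ := mem_unionT.1 hx
  exact subset_A0_of_mem_comps (hT hC) hxC

/-- A union of components is closed inside the sided set. -/
lemma closedIn_unionT {r s : V} {ω : Config E} {T : Finset (Finset V)} (hT : T ⊆ comps ends r s ω) :
    ClosedIn ends (sided ends r s ω) (↑(unionT T) : Set V) := by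
  intro e a b hends ha hb
  obtain ⟨C, hC, haC⟩ := mem_unionT.1 (Finset.mem_coe.1 ha)
  exact Finset.mem_coe.2 (mem_unionT.2 ⟨C, hC, Finset.mem_coe.1
    (closedIn_of_mem_comps (hT hC) e a b hends (Finset.mem_coe.2 haC) hb)⟩)

/-- The union of all components is `A0`. -/
lemma unionT_comps {r s : V} (ω : Config E) : unionT (comps ends r s ω) = A0 ends r s ω := by
  ext x
  rw [mem_unionT]
  constructor
  · rintro ⟨C, hC, hxC⟩
    exact subset_A0_of_mem_comps hC hxC
  · intro hx
    exact ⟨compIn ends (↑(A0 ends r s ω) : Set V) x, Finset.mem_image.2 ⟨x, hx, rfl⟩,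
      mem_compIn_self _ _⟩

/-- A component contained in a union of components is one of them. -/
lemma mem_of_subset_unionT {r s : V} {ω : Config E} {T : Finset (Finset V)}
    (hT : T ⊆ comps ends r s ω) {C : Finset V} (hC : C ∈ comps ends r s ω) (hsub : C ⊆ unionT T) :
    C ∈ T := by
  obtain ⟨y, hy, rfl⟩ := Finset.mem_image.1 hC
  obtain ⟨C', hC', hyC'⟩ := mem_unionT.1 (hsub (mem_compIn_self _ y))
  have : C' = compIn ends (↑(A0 ends r s ω) : Set V) y := eq_compIn_of_mem_comps (hT hC') hyC'
  rw [← this]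
  exact hC'

/-- The components inside a union of components are exactly its members. -/
lemma filter_subset_unionT {r s : V} {ω : Config E} {T : Finset (Finset V)}
    (hT : T ⊆ comps ends r s ω) :
    (comps ends r s ω).filter (fun C => C ⊆ unionT T) = T := by
  ext C
  rw [Finset.mem_filter]
  constructor
  · rintro ⟨hC, hsub⟩
    exact mem_of_subset_unionT hT hC hsub
  · intro hCT
    exact ⟨hT hCT, fun x hx => mem_unionT.2 ⟨C, hCT, hx⟩⟩

/-- The union of the complementary set of components is the complement in `A0`. -/
lemma unionT_sdiff_comps {r s : V} {ω : Config E} {T : Finset (Finset V)}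
    (hT : T ⊆ comps ends r s ω) :
    unionT (comps ends r s ω \ T) = A0 ends r s ω \ unionT T := by
  ext x
  rw [mem_unionT, Finset.mem_sdiff, mem_unionT]
  constructor
  · rintro ⟨C, hC, hxC⟩
    obtain ⟨hCc, hCT⟩ := Finset.mem_sdiff.1 hC
    refine ⟨subset_A0_of_mem_comps hCc hxC, ?_⟩
    rintro ⟨C', hC', hxC'⟩
    have h1 := eq_compIn_of_mem_comps hCc hxC
    have h2 := eq_compIn_of_mem_comps (hT hC') hxC'
    exact hCT (h1.trans h2.symm ▸ hC')
  · rintro ⟨hxA, hx⟩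
    refine ⟨compIn ends (↑(A0 ends r s ω) : Set V) x, Finset.mem_sdiff.2
      ⟨Finset.mem_image.2 ⟨x, hxA, rfl⟩, ?_⟩, mem_compIn_self _ _⟩
    intro hmem
    exact hx ⟨_, hmem, mem_compIn_self _ _⟩

omit [Fintype V] in
/-- `unionT` is monotone. -/
lemma unionT_mono {T T' : Finset (Finset V)} (h : T ⊆ T') : unionT T ⊆ unionT T' := by
  intro x hx
  obtain ⟨C, hC, hxC⟩ := mem_unionT.1 hx
  exact mem_unionT.2 ⟨C, h hC, hxC⟩

/-- The union of a difference of component sets is the difference of the unions. -/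
lemma unionT_sdiff {r s : V} {ω : Config E} {T T' : Finset (Finset V)} (hTT : T ⊆ T')
    (hT' : T' ⊆ comps ends r s ω) : unionT (T' \ T) = unionT T' \ unionT T := by
  ext x
  rw [mem_unionT, Finset.mem_sdiff, mem_unionT, mem_unionT]
  constructor
  · rintro ⟨C, hC, hxC⟩
    obtain ⟨hCT', hCT⟩ := Finset.mem_sdiff.1 hC
    refine ⟨⟨C, hCT', hxC⟩, ?_⟩
    rintro ⟨C', hC', hxC'⟩
    have h1 := eq_compIn_of_mem_comps (hT' hCT') hxC
    have h2 := eq_compIn_of_mem_comps (hT' (hTT hC')) hxC'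
    exact hCT (h1.trans h2.symm ▸ hC')
  · rintro ⟨⟨C, hC, hxC⟩, hx⟩
    refine ⟨C, Finset.mem_sdiff.2 ⟨hC, fun hCT => hx ⟨C, hCT, hxC⟩⟩, hxC⟩

end Count

end SideSwitch

end Summit.Ventures.PercRepro2
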